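import Summits.SmoothPoincare4.SmoothPoincare4.Theses.SymplecticOrigami
import Summits.SmoothPoincare4.SmoothPoincare4.Theorems.SymplecticOrigamiGromovRecognitionRelEndStubCapModelX6

/-!
# Line `cross-cap-laurent`, Stub 3 (`stub_capModel`): the wedge cap of the standard end
(crux `SymplecticOrigami.GromovRecognitionRelEnd` ≡ `SymplecticCap.GromovRecognitionRelEnd` ≡
`Literature.Geometry.Symplectic.gromov_recognitionR4_relEnd`, item stmt-SmoothPoincare4-11009)

This file states and proves the registered stub `stub_capModel` (signature verbatim from the
skeleton of the line): the closed symplectic-tame model `X = ι(M) ⊔ (V∞ ∪ H∞)` of the manifold `M`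
with standard end, obtained by capping the end `{‖ψ‖ > R₁}` (where `J = ψ*(i ⊕ i)`) with the two
spheres at infinity `{z₁ = ∞}`, `{z₂ = ∞}` of `ℂP¹ × ℂP¹`. The whole construction is in the
auxiliary files imported above (namespace `…CrossCapLaurent.CapModel`); here only the assembly.

References: D. McDuff, D. Salamon, *Introduction to Symplectic Topology*, 3rd ed. (2017),
Rem. 4.5.2 (v), §4.1; C. Wendl, *Holomorphic Curves in Low Dimensions* (2018), Thm. 6.8;
M. Gromov, Invent. Math. 82 (1985), §0.3.C; A. Kosinski, *Differential Manifolds* (1993), VI.1.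
-/

noncomputable section

-- the prescribed namespace `Summit.<P>.<Sub>.…` duplicates `SmoothPoincare4` (P = Sub)
set_option linter.dupNamespace false

open scoped Manifold ContDiff Topology
open Set TopologicalSpace Literature.Geometry.Kaehler Literature.Geometry.Symplectic

namespace Summit.SmoothPoincare4.SmoothPoincare4.Theorems.GromovRecognitionRelEnd.CrossCapLaurent

/-- Model space `ℝ⁴ = ℂ²` (coordinates `0,1` = `z₁`, `2,3` = `z₂`). -/
local notation "E4" => EuclideanSpace ℝ (Fin 4)
/-- `ℝ² = ℂ`, the coordinate plane of one factor. -/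
local notation "E2" => EuclideanSpace ℝ (Fin 2)

/-- **Stub 3 of line `cross-cap-laurent` — the WEDGE CAP** (`stub_capModel`, registered signature
verbatim). Given the end data of the crux, Stub 1's openness of the truncations and Stub 2's tame `J`
equal to `ψ*(i ⊕ i)` beyond `R₁ > max R 0`, there is a closed model: a compact connected Hausdorff
second-countable smooth `4`-manifold `X` with a closed smooth `2`-form `ωX` taming a `C^∞` almost
complex structure `JX`, an injective `(J, JX)`-holomorphic local diffeomorphism `ι : M → X`, and three
cap charts `ηV, ηH, ηC` (injective local diffeomorphisms on the polydiscs `{|u| < R₁⁻¹} × ℂ`,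
`ℂ × {|t| < R₁⁻¹}`, `{|u| < R₁⁻¹} × {|t| < R₁⁻¹}`) glued to the end by `ηV (u, z₂) = ι χ (1/u, z₂)`,
`ηH (z₁, t) = ι χ (z₁, 1/t)`, `ηC = ηV ∘ (t ↦ 1/t) = ηH ∘ (u ↦ 1/u)`, with new axis points, in
which `JX` is `i ⊕ i`, and which with `ι(M)` cover `X`.

CONSTRUCTION (files `…StubCapModelAux*`, `…GlueACS*`, `…GlueForm`, `…GlueOpens`, `…Cap1–4`,
`…X1–6`): `X = M ∪_g C` is the open gluing (Kosinski VI.1, tree `SmoothGlueData.Glued`) of `M` with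
the CAP `C = (OV ∪ OH) ∪ OC`, itself glued from the three affine charts `(u, z₂)`, `(z₁, t)`,
`(u, t)` (`u = 1/z₁`, `t = 1/z₂`) of the neighbourhood `{|z₁| > R₁ ∨ |z₂| > R₁} ∪ (ℂP¹ ∨ ℂP¹)` of
the wedge in `ℂP¹ × ℂP¹`, along `x ↦ (point with affine coordinates ψ x)`; Hausdorff because by
Stub 1 `‖ψ‖` is locally bounded on `M` while affine coordinates blow up at the wedge; compact by H5
and three compact polydiscs; connected since `ι(M)` is dense. `JX` glues `J` with `i ⊕ i`
(holomorphy of `g`: `J = ψ*(i⊕i)` beyond `R₁` and `1/z` is holomorphic; the push-forward of a smooth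
section of `End T` along a local diffeomorphism is smooth); `ωX` glues `sf` (modified to `ψ^* ΩM`
on the end, `ΩM = f(|z₁|²)dx₀∧dx₁ + f(|z₂|²)dx₂∧dx₃`, `f ≡ 1` on `[0, R₁²]`, `f = 1/s²` at infinity,
so `= sf` on `K ∪ {‖ψ‖ < R₁}` by H10) with the split radial cap forms, which are constant
`du₀∧du₁ + …` near the spheres at infinity; taming is checked piecewise.
[cite: McDuffSalamon2017, Rem. 4.5.2 (v); Wendl2018, Thm 6.8; Gromov1985, §0.3.C] -/
theorem stub_capModel :
    ∀ (M : Type) [TopologicalSpace M] [T2Space M] [SecondCountableTopology M]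
      [ChartedSpace E4 M] [IsManifold (𝓡 4) ∞ M] [ConnectedSpace M]
      (sf : MForm (𝓡 4) M ℝ 2) (K : Set M) (R : ℝ) (ψ : M → E4) (χ : E4 → M),
      IsSmoothForm sf → IsClosedForm sf →
      (∀ x (v : TangentSpace (𝓡 4) x), v ≠ 0 → ∃ w, sf x ![v, w] ≠ 0) →
      (∀ R', R ≤ R' → IsCompact (K ∪ {x | ‖ψ x‖ ≤ R'})) →
      ContMDiffOn (𝓡 4) 𝓘(ℝ, E4) ∞ ψ Kᶜ →
      ContMDiffOn 𝓘(ℝ, E4) (𝓡 4) ∞ χ (Metric.closedBall (0 : E4) R)ᶜ →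
      Set.BijOn ψ Kᶜ (Metric.closedBall (0 : E4) R)ᶜ →
      (∀ x, x ∈ Kᶜ → χ (ψ x) = x) →
      (∀ x, x ∈ Kᶜ → ∀ v w, sf x ![v, w] =
        stdSymplecticForm (mfderiv (𝓡 4) 𝓘(ℝ, E4) ψ x v) (mfderiv (𝓡 4) 𝓘(ℝ, E4) ψ x w)) →
      (∀ R', R < R' → IsOpen (K ∪ {x | x ∈ Kᶜ ∧ ‖ψ x‖ < R'})) →
      ∀ (R₁ : ℝ) (J : AlmostComplexStructure (𝓡 4) ∞ M), R < R₁ → 0 < R₁ → J.IsTamedBy sf →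
      (∀ x, x ∈ Kᶜ → R₁ < ‖ψ x‖ → ∀ (v : TangentSpace (𝓡 4) x) (a : E4),
          a = mfderiv (𝓡 4) 𝓘(ℝ, E4) ψ x v →
          mfderiv (𝓡 4) 𝓘(ℝ, E4) ψ x (J x v) = WithLp.toLp 2 ![-(a 1), a 0, -(a 3), a 2]) →
      ∃ (X : Type) (_ : TopologicalSpace X) (_ : T2Space X) (_ : SecondCountableTopology X)
        (_ : CompactSpace X) (_ : ConnectedSpace X) (_ : ChartedSpace E4 X) (_ : IsManifold (𝓡 4) ∞ X)
        (ωX : MForm (𝓡 4) X ℝ 2) (JX : AlmostComplexStructure (𝓡 4) ∞ X) (ι : M → X)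
        (ηH ηV ηC : E4 → X),
        (IsSmoothForm ωX ∧ IsClosedForm ωX ∧ JX.IsTamedBy ωX) ∧
        (IsLocalDiffeomorph (𝓡 4) (𝓡 4) ∞ ι ∧ Function.Injective ι ∧
          ∀ (x : M) (v : TangentSpace (𝓡 4) x),
            JX (ι x) (mfderiv (𝓡 4) (𝓡 4) ι x v) = mfderiv (𝓡 4) (𝓡 4) ι x (J x v)) ∧
        (IsLocalDiffeomorphOn 𝓘(ℝ, E4) (𝓡 4) ∞ ηV {p : E4 | p 0 ^ 2 + p 1 ^ 2 < R₁⁻¹ ^ 2} ∧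
          Set.InjOn ηV {p : E4 | p 0 ^ 2 + p 1 ^ 2 < R₁⁻¹ ^ 2} ∧
          (∀ p : E4, p 0 ^ 2 + p 1 ^ 2 < R₁⁻¹ ^ 2 → (p 0 ≠ 0 ∨ p 1 ≠ 0) →
            ηV p = ι (χ (WithLp.toLp 2
              ![p 0 / (p 0 ^ 2 + p 1 ^ 2), -(p 1) / (p 0 ^ 2 + p 1 ^ 2), p 2, p 3]))) ∧
          (∀ p : E4, p 0 = 0 → p 1 = 0 → ηV p ∉ Set.range ι) ∧
          (∀ p : E4, p 0 ^ 2 + p 1 ^ 2 < R₁⁻¹ ^ 2 → ∀ q : E4,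
            JX (ηV p) (mfderiv 𝓘(ℝ, E4) (𝓡 4) ηV p q) =
              mfderiv 𝓘(ℝ, E4) (𝓡 4) ηV p (WithLp.toLp 2 ![-(q 1), q 0, -(q 3), q 2]))) ∧
        (IsLocalDiffeomorphOn 𝓘(ℝ, E4) (𝓡 4) ∞ ηH {p : E4 | p 2 ^ 2 + p 3 ^ 2 < R₁⁻¹ ^ 2} ∧
          Set.InjOn ηH {p : E4 | p 2 ^ 2 + p 3 ^ 2 < R₁⁻¹ ^ 2} ∧
          (∀ p : E4, p 2 ^ 2 + p 3 ^ 2 < R₁⁻¹ ^ 2 → (p 2 ≠ 0 ∨ p 3 ≠ 0) →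
            ηH p = ι (χ (WithLp.toLp 2
              ![p 0, p 1, p 2 / (p 2 ^ 2 + p 3 ^ 2), -(p 3) / (p 2 ^ 2 + p 3 ^ 2)]))) ∧
          (∀ p : E4, p 2 = 0 → p 3 = 0 → ηH p ∉ Set.range ι) ∧
          (∀ p : E4, p 2 ^ 2 + p 3 ^ 2 < R₁⁻¹ ^ 2 → ∀ q : E4,
            JX (ηH p) (mfderiv 𝓘(ℝ, E4) (𝓡 4) ηH p q) =
              mfderiv 𝓘(ℝ, E4) (𝓡 4) ηH p (WithLp.toLp 2 ![-(q 1), q 0, -(q 3), q 2]))) ∧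
        (IsLocalDiffeomorphOn 𝓘(ℝ, E4) (𝓡 4) ∞ ηC
            {p : E4 | p 0 ^ 2 + p 1 ^ 2 < R₁⁻¹ ^ 2 ∧ p 2 ^ 2 + p 3 ^ 2 < R₁⁻¹ ^ 2} ∧
          Set.InjOn ηC {p : E4 | p 0 ^ 2 + p 1 ^ 2 < R₁⁻¹ ^ 2 ∧ p 2 ^ 2 + p 3 ^ 2 < R₁⁻¹ ^ 2} ∧
          (∀ p : E4, p 0 ^ 2 + p 1 ^ 2 < R₁⁻¹ ^ 2 → p 2 ^ 2 + p 3 ^ 2 < R₁⁻¹ ^ 2 →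
            (p 2 ≠ 0 ∨ p 3 ≠ 0) →
            ηC p = ηV (WithLp.toLp 2
              ![p 0, p 1, p 2 / (p 2 ^ 2 + p 3 ^ 2), -(p 3) / (p 2 ^ 2 + p 3 ^ 2)])) ∧
          (∀ p : E4, p 0 ^ 2 + p 1 ^ 2 < R₁⁻¹ ^ 2 → p 2 ^ 2 + p 3 ^ 2 < R₁⁻¹ ^ 2 →
            (p 0 ≠ 0 ∨ p 1 ≠ 0) →
            ηC p = ηH (WithLp.toLp 2
              ![p 0 / (p 0 ^ 2 + p 1 ^ 2), -(p 1) / (p 0 ^ 2 + p 1 ^ 2), p 2, p 3])) ∧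
          ηC 0 ∉ Set.range ι ∧
          (∀ p : E4, p 0 ^ 2 + p 1 ^ 2 < R₁⁻¹ ^ 2 → p 2 ^ 2 + p 3 ^ 2 < R₁⁻¹ ^ 2 → ∀ q : E4,
            JX (ηC p) (mfderiv 𝓘(ℝ, E4) (𝓡 4) ηC p q) =
              mfderiv 𝓘(ℝ, E4) (𝓡 4) ηC p (WithLp.toLp 2 ![-(q 1), q 0, -(q 3), q 2]))) ∧
        (∀ y : X, y ∈ Set.range ι ∨ (∃ p : E4, p 0 ^ 2 + p 1 ^ 2 < R₁⁻¹ ^ 2 ∧ ηV p = y) ∨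
          (∃ p : E4, p 2 ^ 2 + p 3 ^ 2 < R₁⁻¹ ^ 2 ∧ ηH p = y) ∨
          (∃ p : E4, (p 0 ^ 2 + p 1 ^ 2 < R₁⁻¹ ^ 2 ∧ p 2 ^ 2 + p 3 ^ 2 < R₁⁻¹ ^ 2) ∧ ηC p = y)) := by
  intro M _ _ _ _ _ _ sf K R ψ χ h2 h3 h4 h5 h6 h7 h8 h9 h10 hopen R₁ J hR₁ hR₁pos hJt hJstd
  haveI : Fact (0 < R₁) := ⟨hR₁pos⟩
  let H : CapModel.EndHyp sf K R ψ χ R₁ J :=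
    { smooth := h2, closed := h3, nondeg := h4, ends := h5, smooth_ψ := h6, smooth_χ := h7, bij := h8,
      left_inv := h9, pullback_eq := h10, isOpen_trunc := hopen, lt_R₁ := hR₁, R₁_pos := hR₁pos,
      tame := hJt, Jstd := hJstd }
  refine ⟨(CapModel.dX H).Glued, inferInstance, CapModel.t2Space_X H, CapModel.secondCountable_X H,
    CapModel.compactSpace_X H, CapModel.connectedSpace_X H, inferInstance, inferInstance,
    CapModel.ωX H, CapModel.JX H, CapModel.ι H, CapModel.ηH H, CapModel.ηV H, CapModel.ηC H,
    CapModel.ωX_props H, CapModel.ι_props H, ?_, ?_, ?_, CapModel.cover_X H⟩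
  · exact ⟨(CapModel.ηV_localDiffeo_injOn H).1, (CapModel.ηV_localDiffeo_injOn H).2,
      fun p hp h0 => CapModel.ηV_eq_ι H hp h0, fun p h0 h1 => CapModel.ηV_axis H h0 h1,
      fun p hp q => CapModel.JX_ηV H hp q⟩
  · exact ⟨(CapModel.ηH_localDiffeo_injOn H).1, (CapModel.ηH_localDiffeo_injOn H).2,
      fun p hp h0 => CapModel.ηH_eq_ι H hp h0, fun p h0 h1 => CapModel.ηH_axis H h0 h1,
      fun p hp q => CapModel.JX_ηH H hp q⟩
  · exact ⟨(CapModel.ηC_localDiffeo_injOn H).1, (CapModel.ηC_localDiffeo_injOn H).2,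
      fun p h1 h2 h0 => CapModel.ηC_eq_ηV H ⟨h1, h2⟩ h0, fun p h1 h2 h0 => CapModel.ηC_eq_ηH H ⟨h1, h2⟩ h0,
      CapModel.ηC_zero H, fun p h1 h2 q => CapModel.JX_ηC H ⟨h1, h2⟩ q⟩

end Summit.SmoothPoincare4.SmoothPoincare4.Theorems.GromovRecognitionRelEnd.CrossCapLaurent
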